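import Literature.NumberTheory.Rogawski1990.LocalTransfer
import HarnessLib

/-!
# The «T1g-H sockets»: NON-DEGENERATE transfer factors, ADMISSIBLE orbital measure families, and the endoscopic transfer
# `f → f^H` as an EXISTENCE RELATION between classes of test functions ([Rogawski1990] Prop. 4.9.1 (a)) — definitions, no existence claims

Topic `NumberTheory/Rogawski1990`; namespace `Literature.NumberTheory.Rogawski1990` (plus one predicate on the tree's ★
`Literature.NumberTheory.Automorphic.OrbitalMeasureFamily`).  DEFINITIONS WITH BODIES + proved sanity lemmas: **no named fact, no `sorry`, no
instance, no notation**; debt 0.  Imports ★ `Rogawski1990/LocalTransfer` (F0-typ1 (g2) LETTER #3, p798063: `TransferFactorData`, `TransferFactorData.zero`,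
`IsDeltaTransferRel`, `IsDeltaTransfer`, `IsLocalDeltaTransfer`, `LocalTransferFactor`, `IsLocalNormPair`, `IsLocalGRegular`; transitively ★
`Automorphic/LocalOrbitalIntegral`: `OrbitalMeasureFamily`, `classOrbitalIntegral`).

WHY (Hodge-CM cell, floor-0 engine line `Cruxes/H413/Lines/F0_T1InnerFormTraceIdentity.lean`, SPEC-ed1.15 §1–§2 and F0P3a-ref1 NOTE-R1-36).  The transfer
relations of LETTER #3 are honest PARAMETRIC shells — and therefore satisfiable by JUNK parameters: the ZERO measure family (`∫ … ∂0 = 0` makes every orbital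
integral vanish, so `f′ → f` and `f → f^H` hold for every pair) and the ZERO transfer factor ★ `TransferFactorData.zero` (★ `isDeltaTransferRel_zero`: «`f^H = 0`
is a `Δ`-transfer of every `f`»).  An edition that PINS the transfer laws at the finitely many bad places `S₀` must quantify over parameters that exclude both.
This file types the three sockets the pins quantify over:
* §1 `TransferFactorData.IsNondegenerate T greg` — `Δ(γ_H, γ) ≠ 0` on every MATCHING, `G`-REGULAR pair ([Rogawski1990, §4.9 pp. 54–55]:
  `|Δ_{G/H}(γ_H, γ)| = |D_G(γ)|^{1∕2} |D_H(γ_H)|^{-1∕2}` there; [LanglandsShelstad1987]); `not_isNondegenerate_zero`: the zero factor FAILS it as soon as one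
  matching `G`-regular pair exists.
* §1 `OrbitalMeasureFamily.IsAdmissible m` — every member `m_c` is NON-ZERO, `G`-INVARIANT (`SMulInvariantMeasure G (G ⧸ G_{γ_c})`) and FINITE ON COMPACTS
  (the three fields ★ `UnitaryGroup.IsOrbitalTerms` imposes on its `μ_c`; in print the invariant quotients `dg∕dg_γ` of Haar measures, [Rogawski1990, §1.6 p. 6,
  §4.9 p. 54]); `not_isAdmissible_zero`.
* §1 `IsDeltaTransferExistsRel … T mH mG SmoothG SmoothH` — «for all `f ∈ C(G, ω)` there exists `f^H ∈ C(H, ω)` whose orbital integrals match» ([Rogawski1990,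
  §4.3 (4.3.1) p. 43; Prop. 4.9.1 (a) p. 55]) AS A RELATION between two classes of functions `SmoothG`, `SmoothH` (PARAMETERS) for GIVEN `Δ`, `mH`, `mG`:
  `∀ f, SmoothG f → ∃ f^H, SmoothH f^H ∧ IsDeltaTransferRel … T mH mG f^H f`.  Nothing is asserted; `isDeltaTransferExistsRel_zero` records the junk
  witness (`T = 0`, `f^H := 0`) that non-degeneracy is there to exclude.
* §2 the unitary-group instances (`U(σ, J₂) × U(σ, J₁) → U(σ, J₃′)`, ★ `EndoMatches` ∕ `IsGRegular`): `IsDeltaTransferExists`;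
* §3 the CM-local instances on the carriers `(UnitaryGroup.cmDatum L N H).Local v` in LETTER #3's spelling: `IsLocalNondegenerate L H′ v Δ_v`
  (`∀ γ_H γ, IsLocalNormPair … γ_H γ → IsLocalGRegular … γ_H → Δ_v γ_H γ ≠ 0`), `IsLocalDeltaTransferExists L H′ v Δ_v mH mG Smooth′ SmoothH`
  (`∀ φ, Smooth′ φ → ∃ φ^H, SmoothH φ^H ∧ IsLocalDeltaTransfer L H′ v Δ_v mH mG φ^H φ`) with `_iff` unfoldings (`Iff.rfl`) — the shapes SPEC-ed1.15's pin (vi′) and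
  the named hypothesis «`LocalDeltaTransferExists`» ([Rogawski1990, Prop. 4.9.1 (a)]; [LanglandsShelstad1987]) quantify over.  Admissibility of the local measure
  families is `OrbitalMeasureFamily.IsAdmissible` verbatim at these carriers (§3 records the unfolding).
HC_CM is proved only modulo the printed citations until rung 0 closes; this file discharges none of them.

## References
* [Rogawski1990] J. D. Rogawski, *Automorphic Representations of Unitary Groups in Three Variables*, Ann. of Math. Studies 123 (1990): §1.6 p. 6,
  §4.3 (4.3.1) pp. 42–43, §4.9 Prop. 4.9.1 pp. 54–55, §14.2 p. 232.
* [LanglandsShelstad1987] R. P. Langlands, D. Shelstad, *On the definition of transfer factors*, Math. Ann. 278 (1987), §1, §4.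
-/


noncomputable section

open MeasureTheory NumberField IsDedekindDomain

/-! ## §1 Abstract groups: the three sockets -/

namespace Literature.NumberTheory.Automorphic

section Admissible

variable {G : Type*} [Group G] [TopologicalSpace G] [∀ γ : G, MeasurableSpace (G ⧸ Subgroup.centralizer ({γ} : Set G))]

/-- **An ADMISSIBLE family of orbital measures**: every member `m_c` (a measure on `G ⧸ G_{γ_c}`, `γ_c = out c`) is NON-ZERO, INVARIANT under the
left action of `G`, and FINITE ON COMPACT SETS — the three properties of the invariant quotient `dg ∕ dg_γ` of Haar measures that print uses
([Rogawski1990, §1.6 p. 6]: `Φ_G(γ, f) = ∫_{G_γ \ G} f(g⁻¹ γ g) dg`), and exactly the fields ★ `UnitaryGroup.IsOrbitalTerms` records for its `μ_c`.  Excludes the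
junk ZERO family, for which every orbital integral vanishes. [cite: Rogawski1990, §1.6 p. 6; §4.9 p. 54] -/
def OrbitalMeasureFamily.IsAdmissible (m : OrbitalMeasureFamily G) : Prop :=
  ∀ c : ConjClasses G,
    m c ≠ 0 ∧ SMulInvariantMeasure G (G ⧸ Subgroup.centralizer ({(Quotient.out c : G)} : Set G)) (m c) ∧ IsFiniteMeasureOnCompacts (m c)

/-- Unfolding of `OrbitalMeasureFamily.IsAdmissible`. [cite: Rogawski1990, §1.6 p. 6] -/
theorem OrbitalMeasureFamily.isAdmissible_iff (m : OrbitalMeasureFamily G) :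
    m.IsAdmissible ↔ ∀ c : ConjClasses G,
      m c ≠ 0 ∧ SMulInvariantMeasure G (G ⧸ Subgroup.centralizer ({(Quotient.out c : G)} : Set G)) (m c) ∧ IsFiniteMeasureOnCompacts (m c) :=
  Iff.rfl

/-- The members of an admissible family are non-zero. [cite: Rogawski1990, §1.6 p. 6] -/
theorem OrbitalMeasureFamily.IsAdmissible.ne_zero {m : OrbitalMeasureFamily G} (h : m.IsAdmissible) (c : ConjClasses G) : m c ≠ 0 :=
  (h c).1

/-- The members of an admissible family are `G`-invariant. [cite: Rogawski1990, §1.6 p. 6] -/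
theorem OrbitalMeasureFamily.IsAdmissible.smulInvariantMeasure {m : OrbitalMeasureFamily G} (h : m.IsAdmissible) (c : ConjClasses G) :
    SMulInvariantMeasure G (G ⧸ Subgroup.centralizer ({(Quotient.out c : G)} : Set G)) (m c) :=
  (h c).2.1

/-- The members of an admissible family are finite on compact sets. [cite: Rogawski1990, §1.6 p. 6] -/
theorem OrbitalMeasureFamily.IsAdmissible.isFiniteMeasureOnCompacts {m : OrbitalMeasureFamily G} (h : m.IsAdmissible) (c : ConjClasses G) :
    IsFiniteMeasureOnCompacts (m c) :=
  (h c).2.2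

/-- **The junk witness is excluded**: the ZERO family of orbital measures is not admissible (its member at the class of `1` is `0`).
[cite: Rogawski1990, §1.6 p. 6] -/
theorem OrbitalMeasureFamily.not_isAdmissible_zero : ¬ (0 : OrbitalMeasureFamily G).IsAdmissible :=
  fun h => (h (ConjClasses.mk 1)).1 rfl

end Admissible

end Literature.NumberTheory.Automorphic

namespace Literature.NumberTheory.Rogawski1990

open Literature.NumberTheory.Automorphic
open Literature.AlgebraicGeometry.ShimuraVarieties (unitaryGroup)

section Abstract

variable {A B : Type*} [Group A] [Group B]

/-- **NON-DEGENERACY of a transfer factor** on the matching (`R`), `G`-regular (`greg`) pairs: `Δ(γ_H, γ) ≠ 0` whenever `γ_H → γ` and `γ_H` is `G`-regular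
([Rogawski1990, §4.9 pp. 54–55]: on such pairs `|Δ_{G/H}(γ_H, γ)| = |D_G(γ)|^{1∕2} |D_H(γ_H)|^{-1∕2} ≠ 0`).  The predicate a pinned transfer law must demand of its
factor, so that the zero factor (for which `f^H := 0` transfers everything) is not a witness. [cite: Rogawski1990, §4.9 pp. 54–55] [cite: LanglandsShelstad1987, §1] -/
def TransferFactorData.IsNondegenerate {R : A → B → Prop} (T : TransferFactorData A B R) (greg : A → Prop) : Prop :=
  ∀ (a : A) (b : B), R a b → greg a → T.Δ a b ≠ 0

/-- Unfolding of `TransferFactorData.IsNondegenerate`. [cite: Rogawski1990, §4.9 pp. 54–55] -/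
theorem TransferFactorData.isNondegenerate_iff {R : A → B → Prop} (T : TransferFactorData A B R) (greg : A → Prop) :
    T.IsNondegenerate greg ↔ ∀ (a : A) (b : B), R a b → greg a → T.Δ a b ≠ 0 :=
  Iff.rfl

/-- A non-degenerate factor does not vanish at a matching `G`-regular pair. [cite: Rogawski1990, §4.9 pp. 54–55] -/
theorem TransferFactorData.IsNondegenerate.Δ_ne_zero {R : A → B → Prop} {T : TransferFactorData A B R} {greg : A → Prop}
    (h : T.IsNondegenerate greg) {a : A} {b : B} (hab : R a b) (ha : greg a) : T.Δ a b ≠ 0 :=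
  h a b hab ha

/-- **The junk witness is excluded**: as soon as ONE matching `G`-regular pair exists, the ZERO transfer factor ★ `TransferFactorData.zero` is NOT
non-degenerate. [cite: Rogawski1990, §4.9 pp. 54–55] -/
theorem TransferFactorData.not_isNondegenerate_zero (R : A → B → Prop) (greg : A → Prop) (h : ∃ (a : A) (b : B), R a b ∧ greg a) :
    ¬ (TransferFactorData.zero A B R).IsNondegenerate greg := by
  rintro hT
  obtain ⟨a, b, hab, ha⟩ := h
  exact hT a b hab ha (TransferFactorData.zero_Δ A B R a b)

/-- Conversely, with NO matching `G`-regular pair the condition is vacuous (even for the zero factor) — non-degeneracy is a constraint only through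
the matching relation. [cite: Rogawski1990, §4.9 pp. 54–55] -/
theorem TransferFactorData.isNondegenerate_of_forall_not {R : A → B → Prop} (T : TransferFactorData A B R) (greg : A → Prop)
    (h : ∀ (a : A) (b : B), R a b → ¬ greg a) : T.IsNondegenerate greg :=
  fun a b hab ha => absurd ha (h a b hab)

variable [∀ a : A, MeasurableSpace (A ⧸ Subgroup.centralizer ({a} : Set A))]
  [∀ b : B, MeasurableSpace (B ⧸ Subgroup.centralizer ({b} : Set B))]

/-- **`f → f^H` as an EXISTENCE RELATION between two classes of functions, abstract form of [Prop. 4.9.1 (a)]**: for the GIVEN transfer factor `T`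
and measure families `mH`, `mG`, every `f` of the class `SmoothG` («`C(G, ω)`») admits some `f^H` of the class `SmoothH` («`C(H, ω)`») with
`IsDeltaTransferRel … T mH mG f^H f` ((4.3.1) at every `G`-regular `γ_H`).  ALL data — factor, measures, the two classes — are PARAMETERS; the relation
ASSERTS NOTHING by itself (it is the shape of a hypothesis ∕ of a pin).  CONSUMER REQUIREMENT (F0P3a-ref1 NOTE-R1-36 (5)): the content of
[Prop. 4.9.1 (a)] is `f^H ∈ C_c^∞(H)`; with `SmoothH := fun _ => True` (or «measurable») the relation is satisfiable even for a non-degenerate factor and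
admissible measures (`G`-regular orbits are closed and pairwise disjoint, so an `f^H` with prescribed orbital integrals can be manufactured orbit by orbit),
so a consumer must instantiate `SmoothH`∕`SmoothG` at genuine test-function classes (compactly supported, locally constant at a finite place).
[cite: Rogawski1990, §4.3 (4.3.1) p. 43; §4.9 Prop. 4.9.1 (a) p. 55] [cite: LanglandsShelstad1987, §1] -/
def IsDeltaTransferExistsRel (R : A → B → Prop) (stA : A → A → Prop) (regA : A → Prop) (T : TransferFactorData A B R)
    (mH : OrbitalMeasureFamily A) (mG : OrbitalMeasureFamily B) (SmoothG : (B → ℂ) → Prop) (SmoothH : (A → ℂ) → Prop) : Prop :=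
  ∀ f : B → ℂ, SmoothG f → ∃ fH : A → ℂ, SmoothH fH ∧ IsDeltaTransferRel R stA regA T mH mG fH f

/-- Unfolding of `IsDeltaTransferExistsRel`. [cite: Rogawski1990, §4.9 Prop. 4.9.1 (a) p. 55] -/
theorem isDeltaTransferExistsRel_iff (R : A → B → Prop) (stA : A → A → Prop) (regA : A → Prop) (T : TransferFactorData A B R)
    (mH : OrbitalMeasureFamily A) (mG : OrbitalMeasureFamily B) (SmoothG : (B → ℂ) → Prop) (SmoothH : (A → ℂ) → Prop) :
    IsDeltaTransferExistsRel R stA regA T mH mG SmoothG SmoothH ↔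
      ∀ f : B → ℂ, SmoothG f → ∃ fH : A → ℂ, SmoothH fH ∧ IsDeltaTransferRel R stA regA T mH mG fH f :=
  Iff.rfl

/-- Extracting a transfer `f^H` of a given `f`. [cite: Rogawski1990, §4.9 Prop. 4.9.1 (a) p. 55] -/
theorem IsDeltaTransferExistsRel.exists {R : A → B → Prop} {stA : A → A → Prop} {regA : A → Prop} {T : TransferFactorData A B R}
    {mH : OrbitalMeasureFamily A} {mG : OrbitalMeasureFamily B} {SmoothG : (B → ℂ) → Prop} {SmoothH : (A → ℂ) → Prop}
    (h : IsDeltaTransferExistsRel R stA regA T mH mG SmoothG SmoothH) {f : B → ℂ} (hf : SmoothG f) :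
    ∃ fH : A → ℂ, SmoothH fH ∧ IsDeltaTransferRel R stA regA T mH mG fH f :=
  h f hf

/-- The relation is MONOTONE in the classes: shrinking `SmoothG` or enlarging `SmoothH` preserves it. [cite: Rogawski1990, §4.9 Prop. 4.9.1 (a) p. 55] -/
theorem IsDeltaTransferExistsRel.mono {R : A → B → Prop} {stA : A → A → Prop} {regA : A → Prop} {T : TransferFactorData A B R}
    {mH : OrbitalMeasureFamily A} {mG : OrbitalMeasureFamily B} {SmoothG SmoothG' : (B → ℂ) → Prop} {SmoothH SmoothH' : (A → ℂ) → Prop}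
    (h : IsDeltaTransferExistsRel R stA regA T mH mG SmoothG SmoothH) (hG : ∀ f, SmoothG' f → SmoothG f) (hH : ∀ fH, SmoothH fH → SmoothH' fH) :
    IsDeltaTransferExistsRel R stA regA T mH mG SmoothG' SmoothH' := by
  intro f hf
  obtain ⟨fH, hfH, ht⟩ := h f (hG f hf)
  exact ⟨fH, hH fH hfH, ht⟩

/-- **The junk witness, recorded**: for the ZERO transfer factor the existence relation holds for ANY classes as soon as `SmoothH 0` (take `f^H := 0`,
★ `isDeltaTransferRel_zero`) — which is why a pin must demand `TransferFactorData.IsNondegenerate` of its factor.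
[cite: Rogawski1990, §4.9 Prop. 4.9.1 (a) p. 55] -/
theorem isDeltaTransferExistsRel_zero (R : A → B → Prop) (stA : A → A → Prop) (regA : A → Prop)
    (mH : OrbitalMeasureFamily A) (mG : OrbitalMeasureFamily B) (SmoothG : (B → ℂ) → Prop) {SmoothH : (A → ℂ) → Prop} (h0 : SmoothH 0) :
    IsDeltaTransferExistsRel R stA regA (TransferFactorData.zero A B R) mH mG SmoothG SmoothH :=
  fun f _ => ⟨0, h0, isDeltaTransferRel_zero R stA regA mH mG f⟩

end Abstract

/-! ## §2 Unitary groups over a commutative ring: `f → f^H` for `H(F) = U(σ, J₂) × U(σ, J₁)`, `G′ = U(σ, J₃′)` -/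

section Unitary

variable {R : Type*} [CommRing R] (σ : R →+* R)
  (J₂ : Matrix (Fin 2) (Fin 2) R) (J₁ : Matrix (Fin 1) (Fin 1) R) (J₃ : Matrix (Fin 3) (Fin 3) R) (J₃' : Matrix (Fin 3) (Fin 3) R)
  [∀ a : unitaryGroup σ J₂ × unitaryGroup σ J₁,
    MeasurableSpace ((unitaryGroup σ J₂ × unitaryGroup σ J₁) ⧸ Subgroup.centralizer ({a} : Set (unitaryGroup σ J₂ × unitaryGroup σ J₁)))]
  [∀ γ : unitaryGroup σ J₃', MeasurableSpace (unitaryGroup σ J₃' ⧸ Subgroup.centralizer ({γ} : Set (unitaryGroup σ J₃')))]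

/-- **`f → f^H` EXISTS on the class `SmoothG`, with transfers in `SmoothH`** — [Prop. 4.9.1 (a)] AS A RELATION for the unitary endoscopic pair
(`H(F) = U(σ, J₂)(R) × U(σ, J₁)(R)`, `G′ = U(σ, J₃′)(R)`, matching ★ `EndoMatches`, `G`-regularity ★ `IsGRegular`): every `f ∈ SmoothG` has some `f^H ∈ SmoothH`
with ★ `IsDeltaTransfer σ J₂ J₁ J₃ J₃′ h T mH mG f^H f`.  PARAMETERS throughout; nothing asserted. [cite: Rogawski1990, §4.9 Prop. 4.9.1 (a) p. 55; §4.3 (4.3.1) p. 43] -/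
def IsDeltaTransferExists (h : endoForm J₂ J₁ = J₃)
    (T : TransferFactorData (unitaryGroup σ J₂ × unitaryGroup σ J₁) (unitaryGroup σ J₃') (EndoMatches σ J₂ J₁ J₃ J₃' h))
    (mH : OrbitalMeasureFamily (unitaryGroup σ J₂ × unitaryGroup σ J₁)) (mG : OrbitalMeasureFamily (unitaryGroup σ J₃'))
    (SmoothG : (unitaryGroup σ J₃' → ℂ) → Prop) (SmoothH : (unitaryGroup σ J₂ × unitaryGroup σ J₁ → ℂ) → Prop) : Prop :=
  IsDeltaTransferExistsRel (EndoMatches σ J₂ J₁ J₃ J₃' h) (IsStablyConjH σ J₂ J₁) (IsGRegular σ J₂ J₁ J₃ h) T mH mG SmoothG SmoothH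

variable {σ J₂ J₁ J₃ J₃'}

/-- Unfolding of `IsDeltaTransferExists` through ★ `IsDeltaTransfer`. [cite: Rogawski1990, §4.9 Prop. 4.9.1 (a) p. 55] -/
theorem isDeltaTransferExists_iff (h : endoForm J₂ J₁ = J₃)
    (T : TransferFactorData (unitaryGroup σ J₂ × unitaryGroup σ J₁) (unitaryGroup σ J₃') (EndoMatches σ J₂ J₁ J₃ J₃' h))
    (mH : OrbitalMeasureFamily (unitaryGroup σ J₂ × unitaryGroup σ J₁)) (mG : OrbitalMeasureFamily (unitaryGroup σ J₃'))
    (SmoothG : (unitaryGroup σ J₃' → ℂ) → Prop) (SmoothH : (unitaryGroup σ J₂ × unitaryGroup σ J₁ → ℂ) → Prop) :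
    IsDeltaTransferExists σ J₂ J₁ J₃ J₃' h T mH mG SmoothG SmoothH ↔
      ∀ f : unitaryGroup σ J₃' → ℂ, SmoothG f →
        ∃ fH : unitaryGroup σ J₂ × unitaryGroup σ J₁ → ℂ, SmoothH fH ∧ IsDeltaTransfer σ J₂ J₁ J₃ J₃' h T mH mG fH f :=
  Iff.rfl

/-- The junk witness at the unitary carriers: the zero factor with `f^H := 0`. [cite: Rogawski1990, §4.9 Prop. 4.9.1 (a) p. 55] -/
theorem isDeltaTransferExists_zero (h : endoForm J₂ J₁ = J₃)
    (mH : OrbitalMeasureFamily (unitaryGroup σ J₂ × unitaryGroup σ J₁)) (mG : OrbitalMeasureFamily (unitaryGroup σ J₃'))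
    (SmoothG : (unitaryGroup σ J₃' → ℂ) → Prop) {SmoothH : (unitaryGroup σ J₂ × unitaryGroup σ J₁ → ℂ) → Prop} (h0 : SmoothH 0) :
    IsDeltaTransferExists σ J₂ J₁ J₃ J₃' h (TransferFactorData.zero _ _ _) mH mG SmoothG SmoothH :=
  isDeltaTransferExistsRel_zero _ _ _ mH mG SmoothG h0

end Unitary

/-! ## §3 The CM-local instances on `(UnitaryGroup.cmDatum L N H).Local v` (LETTER #3's spelling) -/

section CM

variable (L : Type) [Field L] [NumberField L] [IsCMField L] (N : ℕ) (H : Matrix (Fin N) (Fin N) L)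
  (H' : Matrix (Fin 3) (Fin 3) L) (v : HeightOneSpectrum (𝓞 ↥(maximalRealSubfield L)))

/-- **NON-DEGENERACY of a local transfer factor `Δ_v` at the finite place `v`** (on the `cmDatum` carriers):
`∀ γ_H γ, IsLocalNormPair L H′ v γ_H γ → IsLocalGRegular L v γ_H → Δ_v γ_H γ ≠ 0` — the constraint SPEC-ed1.15's pin (vi′) places on the factors it quantifies
over ([Rogawski1990, §4.9 pp. 54–55]: `|Δ_{G/H}| = |D_G|^{1∕2}|D_H|^{-1∕2}` on matching `G`-regular pairs). [cite: Rogawski1990, §4.9 pp. 54–55] [cite: LanglandsShelstad1987, §1] -/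
abbrev IsLocalNondegenerate (T : LocalTransferFactor L H' v) : Prop :=
  T.IsNondegenerate (IsLocalGRegular L v)

/-- `IsLocalNondegenerate` unfolded, token for token as the pin reads it. [cite: Rogawski1990, §4.9 pp. 54–55] -/
theorem isLocalNondegenerate_iff (T : LocalTransferFactor L H' v) :
    IsLocalNondegenerate L H' v T ↔
      ∀ (γH : (UnitaryGroup.cmDatum L 2 (Matrix.of fun i j : Fin 2 => if i.val + j.val + 1 = 2 then (1 : L) else 0)).Local v ×
          (UnitaryGroup.cmDatum L 1 (Matrix.of fun i j : Fin 1 => if i.val + j.val + 1 = 1 then (1 : L) else 0)).Local v)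
        (γ : (UnitaryGroup.cmDatum L 3 H').Local v),
        IsLocalNormPair L H' v γH γ → IsLocalGRegular L v γH → T.Δ γH γ ≠ 0 :=
  Iff.rfl

/-- The ZERO local factor is NOT non-degenerate as soon as one matching `G`-regular pair exists at `v`. [cite: Rogawski1990, §4.9 pp. 54–55] -/
theorem not_isLocalNondegenerate_zero
    (h : ∃ (γH : (UnitaryGroup.cmDatum L 2 (Matrix.of fun i j : Fin 2 => if i.val + j.val + 1 = 2 then (1 : L) else 0)).Local v ×
          (UnitaryGroup.cmDatum L 1 (Matrix.of fun i j : Fin 1 => if i.val + j.val + 1 = 1 then (1 : L) else 0)).Local v)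
        (γ : (UnitaryGroup.cmDatum L 3 H').Local v), IsLocalNormPair L H' v γH γ ∧ IsLocalGRegular L v γH) :
    ¬ IsLocalNondegenerate L H' v (TransferFactorData.zero _ _ _) :=
  TransferFactorData.not_isNondegenerate_zero _ _ h

/-- **ADMISSIBILITY of a local orbital measure family** on `G_v = U(H)(L⁺_v)` is ★ `OrbitalMeasureFamily.IsAdmissible` verbatim at the `cmDatum` carrier:
every member non-zero, `G_v`-invariant, finite on compacts (unfolding recorded for the pin). [cite: Rogawski1990, §1.6 p. 6; §4.9 p. 54] -/
theorem isAdmissible_local_iff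
    {_hγ : ∀ γ : (UnitaryGroup.cmDatum L N H).Local v,
      MeasurableSpace ((UnitaryGroup.cmDatum L N H).Local v ⧸ Subgroup.centralizer ({γ} : Set ((UnitaryGroup.cmDatum L N H).Local v)))}
    (m : OrbitalMeasureFamily ((UnitaryGroup.cmDatum L N H).Local v)) :
    m.IsAdmissible ↔ ∀ c : ConjClasses ((UnitaryGroup.cmDatum L N H).Local v),
      m c ≠ 0 ∧
        SMulInvariantMeasure ((UnitaryGroup.cmDatum L N H).Local v)
          ((UnitaryGroup.cmDatum L N H).Local v ⧸
            Subgroup.centralizer ({(Quotient.out c : (UnitaryGroup.cmDatum L N H).Local v)} : Set ((UnitaryGroup.cmDatum L N H).Local v))) (m c) ∧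
        IsFiniteMeasureOnCompacts (m c) :=
  Iff.rfl

/-- **`φ_v → φ^H_v` EXISTS at the finite place `v`** — [Rogawski1990, Prop. 4.9.1 (a)] AS A RELATION on the `cmDatum` carriers, for a GIVEN local factor
`Δ_v` and GIVEN local measure families: `∀ φ, Smooth′ φ → ∃ φ^H, SmoothH φ^H ∧ IsLocalDeltaTransfer L H′ v Δ_v mH mG φ^H φ`.  The two classes `Smooth′`
(test functions on `G′_v = U(H′)(L⁺_v)`) and `SmoothH` (on `H_v = U(Φ₂)(L⁺_v) × U(Φ₁)(L⁺_v)`) are PARAMETERS (the line's kit supplies them); nothing is asserted —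
this is the shape of the named hypothesis «`LocalDeltaTransferExists`» of SPEC-ed1.15 §2 at one place, to be instantiated at GENUINE test-function classes
(`SmoothH := ⊤` is the third junk witness, NOTE-R1-36 (5)). [cite: Rogawski1990, §4.9 Prop. 4.9.1 (a) p. 55] [cite: LanglandsShelstad1987, §1] -/
abbrev IsLocalDeltaTransferExists
    {_ha : ∀ a : ((UnitaryGroup.cmDatum L 2 (Matrix.of fun i j : Fin 2 => if i.val + j.val + 1 = 2 then (1 : L) else 0)).Local v ×
        (UnitaryGroup.cmDatum L 1 (Matrix.of fun i j : Fin 1 => if i.val + j.val + 1 = 1 then (1 : L) else 0)).Local v),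
      MeasurableSpace (((UnitaryGroup.cmDatum L 2 (Matrix.of fun i j : Fin 2 => if i.val + j.val + 1 = 2 then (1 : L) else 0)).Local v ×
        (UnitaryGroup.cmDatum L 1 (Matrix.of fun i j : Fin 1 => if i.val + j.val + 1 = 1 then (1 : L) else 0)).Local v) ⧸
        Subgroup.centralizer ({a} : Set ((UnitaryGroup.cmDatum L 2 (Matrix.of fun i j : Fin 2 => if i.val + j.val + 1 = 2 then (1 : L) else 0)).Local v ×
        (UnitaryGroup.cmDatum L 1 (Matrix.of fun i j : Fin 1 => if i.val + j.val + 1 = 1 then (1 : L) else 0)).Local v)))}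
    {_hγ : ∀ γ : (UnitaryGroup.cmDatum L 3 H').Local v,
      MeasurableSpace ((UnitaryGroup.cmDatum L 3 H').Local v ⧸ Subgroup.centralizer ({γ} : Set ((UnitaryGroup.cmDatum L 3 H').Local v)))}
    (T : LocalTransferFactor L H' v)
    (mH : OrbitalMeasureFamily ((UnitaryGroup.cmDatum L 2 (Matrix.of fun i j : Fin 2 => if i.val + j.val + 1 = 2 then (1 : L) else 0)).Local v ×
        (UnitaryGroup.cmDatum L 1 (Matrix.of fun i j : Fin 1 => if i.val + j.val + 1 = 1 then (1 : L) else 0)).Local v))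
    (mG : OrbitalMeasureFamily ((UnitaryGroup.cmDatum L 3 H').Local v))
    (Smooth' : ((UnitaryGroup.cmDatum L 3 H').Local v → ℂ) → Prop)
    (SmoothH : (((UnitaryGroup.cmDatum L 2 (Matrix.of fun i j : Fin 2 => if i.val + j.val + 1 = 2 then (1 : L) else 0)).Local v ×
        (UnitaryGroup.cmDatum L 1 (Matrix.of fun i j : Fin 1 => if i.val + j.val + 1 = 1 then (1 : L) else 0)).Local v) → ℂ) → Prop) : Prop :=
  IsDeltaTransferExistsRel (IsLocalNormPair L H' v) (IsLocalStablyConjH L v) (IsLocalGRegular L v) T mH mG Smooth' SmoothH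

/-- `IsLocalDeltaTransferExists` unfolded, token for token as the named hypothesis reads it. [cite: Rogawski1990, §4.9 Prop. 4.9.1 (a) p. 55] -/
theorem isLocalDeltaTransferExists_iff
    {_ha : ∀ a : ((UnitaryGroup.cmDatum L 2 (Matrix.of fun i j : Fin 2 => if i.val + j.val + 1 = 2 then (1 : L) else 0)).Local v ×
        (UnitaryGroup.cmDatum L 1 (Matrix.of fun i j : Fin 1 => if i.val + j.val + 1 = 1 then (1 : L) else 0)).Local v),
      MeasurableSpace (((UnitaryGroup.cmDatum L 2 (Matrix.of fun i j : Fin 2 => if i.val + j.val + 1 = 2 then (1 : L) else 0)).Local v ×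
        (UnitaryGroup.cmDatum L 1 (Matrix.of fun i j : Fin 1 => if i.val + j.val + 1 = 1 then (1 : L) else 0)).Local v) ⧸
        Subgroup.centralizer ({a} : Set ((UnitaryGroup.cmDatum L 2 (Matrix.of fun i j : Fin 2 => if i.val + j.val + 1 = 2 then (1 : L) else 0)).Local v ×
        (UnitaryGroup.cmDatum L 1 (Matrix.of fun i j : Fin 1 => if i.val + j.val + 1 = 1 then (1 : L) else 0)).Local v)))}
    {_hγ : ∀ γ : (UnitaryGroup.cmDatum L 3 H').Local v,
      MeasurableSpace ((UnitaryGroup.cmDatum L 3 H').Local v ⧸ Subgroup.centralizer ({γ} : Set ((UnitaryGroup.cmDatum L 3 H').Local v)))}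
    (T : LocalTransferFactor L H' v)
    (mH : OrbitalMeasureFamily ((UnitaryGroup.cmDatum L 2 (Matrix.of fun i j : Fin 2 => if i.val + j.val + 1 = 2 then (1 : L) else 0)).Local v ×
        (UnitaryGroup.cmDatum L 1 (Matrix.of fun i j : Fin 1 => if i.val + j.val + 1 = 1 then (1 : L) else 0)).Local v))
    (mG : OrbitalMeasureFamily ((UnitaryGroup.cmDatum L 3 H').Local v))
    (Smooth' : ((UnitaryGroup.cmDatum L 3 H').Local v → ℂ) → Prop)
    (SmoothH : (((UnitaryGroup.cmDatum L 2 (Matrix.of fun i j : Fin 2 => if i.val + j.val + 1 = 2 then (1 : L) else 0)).Local v ×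
        (UnitaryGroup.cmDatum L 1 (Matrix.of fun i j : Fin 1 => if i.val + j.val + 1 = 1 then (1 : L) else 0)).Local v) → ℂ) → Prop) :
    IsLocalDeltaTransferExists L H' v T mH mG Smooth' SmoothH ↔
      ∀ φ : (UnitaryGroup.cmDatum L 3 H').Local v → ℂ, Smooth' φ →
        ∃ φH : ((UnitaryGroup.cmDatum L 2 (Matrix.of fun i j : Fin 2 => if i.val + j.val + 1 = 2 then (1 : L) else 0)).Local v ×
            (UnitaryGroup.cmDatum L 1 (Matrix.of fun i j : Fin 1 => if i.val + j.val + 1 = 1 then (1 : L) else 0)).Local v) → ℂ,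
          SmoothH φH ∧ IsLocalDeltaTransfer L H' v T mH mG φH φ :=
  Iff.rfl

/-- The junk witness at `v`, recorded: with the ZERO local factor, `φ^H := 0` transfers every `φ` (★ `isLocalDeltaTransfer_zero`), so the relation holds for
any classes with `SmoothH 0` — the reason the pin pairs it with `IsLocalNondegenerate`. [cite: Rogawski1990, §4.9 Prop. 4.9.1 (a) p. 55] -/
theorem isLocalDeltaTransferExists_zero
    {_ha : ∀ a : ((UnitaryGroup.cmDatum L 2 (Matrix.of fun i j : Fin 2 => if i.val + j.val + 1 = 2 then (1 : L) else 0)).Local v ×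
        (UnitaryGroup.cmDatum L 1 (Matrix.of fun i j : Fin 1 => if i.val + j.val + 1 = 1 then (1 : L) else 0)).Local v),
      MeasurableSpace (((UnitaryGroup.cmDatum L 2 (Matrix.of fun i j : Fin 2 => if i.val + j.val + 1 = 2 then (1 : L) else 0)).Local v ×
        (UnitaryGroup.cmDatum L 1 (Matrix.of fun i j : Fin 1 => if i.val + j.val + 1 = 1 then (1 : L) else 0)).Local v) ⧸
        Subgroup.centralizer ({a} : Set ((UnitaryGroup.cmDatum L 2 (Matrix.of fun i j : Fin 2 => if i.val + j.val + 1 = 2 then (1 : L) else 0)).Local v ×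
        (UnitaryGroup.cmDatum L 1 (Matrix.of fun i j : Fin 1 => if i.val + j.val + 1 = 1 then (1 : L) else 0)).Local v)))}
    {_hγ : ∀ γ : (UnitaryGroup.cmDatum L 3 H').Local v,
      MeasurableSpace ((UnitaryGroup.cmDatum L 3 H').Local v ⧸ Subgroup.centralizer ({γ} : Set ((UnitaryGroup.cmDatum L 3 H').Local v)))}
    (mH : OrbitalMeasureFamily ((UnitaryGroup.cmDatum L 2 (Matrix.of fun i j : Fin 2 => if i.val + j.val + 1 = 2 then (1 : L) else 0)).Local v ×
        (UnitaryGroup.cmDatum L 1 (Matrix.of fun i j : Fin 1 => if i.val + j.val + 1 = 1 then (1 : L) else 0)).Local v))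
    (mG : OrbitalMeasureFamily ((UnitaryGroup.cmDatum L 3 H').Local v))
    (Smooth' : ((UnitaryGroup.cmDatum L 3 H').Local v → ℂ) → Prop)
    {SmoothH : (((UnitaryGroup.cmDatum L 2 (Matrix.of fun i j : Fin 2 => if i.val + j.val + 1 = 2 then (1 : L) else 0)).Local v ×
        (UnitaryGroup.cmDatum L 1 (Matrix.of fun i j : Fin 1 => if i.val + j.val + 1 = 1 then (1 : L) else 0)).Local v) → ℂ) → Prop}
    (h0 : SmoothH 0) :
    IsLocalDeltaTransferExists L H' v (TransferFactorData.zero _ _ _) mH mG Smooth' SmoothH :=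
  isDeltaTransferExistsRel_zero _ _ _ mH mG Smooth' h0

end CM

end Literature.NumberTheory.Rogawski1990

end
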